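import Summits.CriticalPhenomena.Ising3DConformalLimit.Theses.PrimaryAtInfinity
import Literature.Probability.LatticeModels.FarFieldExpansionTwoPoint
import HarnessLib
import HarnessLib.Audit

/-!
# Birth skeleton (BC3) for crux `FarFieldClustering` — item stmt-CriticalPhenomena-5353, route `PrimaryAtInfinity`, rank 3

Registered file `Cruxes/FarFieldClustering/Lines/birth.lean` (planner-skel-stmt-CriticalPhenomena-5353-0, 2026-08-17).

THE CRUX (by name `PrimaryAtInfinity.FarFieldClustering`; grounded g13-38, route-review c23efa21, XL): for every
pointwise scaling limit `S` of `criticalCorr 3` (renormalisation `ρ > 0` on `(0,1]`) which is normalised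
(`S = 0` off `NonCoincident`) and has two-point function `S 2 ![a,b] = c‖a−b‖^(−2Δ)` (`c > 0`), every `n` and
every pair `(A₀, A₁)` of far-field (monopole/dipole) coefficients of `S (n+2)` — the expansion clause is
VERBATIM `Literature.Probability.LatticeModels.HasFarFieldExpansion S Δ (n+1) A₀ A₁` (`Iff.rfl`) —

* MONOPOLE clustering with rate: `‖z‖ · (A₀ (x,z) − c · S n x) → 0`, and
* DIPOLE clustering: `A₁ (x,z) − (2Δ c · S n x) • z → 0`,

both as `z → ∞` (`cocompact`), locally uniformly in `x ∈ NonCoincident 3 n`.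

THE LINE (the route's own two-layer plan "FarFieldClustering ⇐ MonopoleClusteringRate → DipoleClustering",
with the strict inequality `η > 0` that both rates consume made an explicit, separately attackable piece):

* STUB 1 `stub_eta_pos` — **η > 0 for power-law limits**: under the crux hypotheses, `1/2 < Δ`. This is where
  the anomalous dimension is load-bearing: both clustering rates below have natural size `‖z‖^(1−2Δ) = ‖z‖^(−η)`.
  A CONSEQUENCE of the sibling crux `PrimaryAtInfinity.TwoPointPowerLawEta` (item 5354: a limit with the
  two-point law `c‖·‖^(−2Δ)`, `c > 0`, is `IsNondegenerateTwoPoint`, and comparing the two power laws at distances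
  1 and 2 gives `Δ = Δ' > 1/2`), strictly weaker than it (no isotropy / pure-power content: those are hypotheses
  here). Open (η(3) ≈ 0.0363 by the conformal bootstrap; rigorously only `c‖x‖⁻² ≤ ⟨σ₀σ_x⟩ ≤ C‖x‖⁻¹`).
* STUB 2 `stub_monopole_rate` — **monopole clustering with rate `o(1/‖z‖)`, given `1/2 < Δ`**: the
  inequality-routine half (retriage note 2026-08-15). Foreseen proof, all lattice inputs in tree: GKS II and the
  Glimm–Jaffe pair-truncation tree bound in the critical plus state (`plusCorr_two_mul_cov_le_sum_odd_of_free_eq_plus`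
  with `freeCorr_eq_plusCorr_of_spontaneousMagnetization_eq_zero` + `spontaneousMagnetization_criticalBeta_eq_zero_holds`;
  named fact `glimmJaffe_pairTruncation_treeBound`, discharged `…_holds`), rescaled by `ρ(δ)^(n+2)` and passed to
  the limit at non-coincident configurations (`criticalCorr_comp_equiv_eq`, `HasPointwiseScalingLimit.eq_zero_of_odd`):
  `0 ≤ S(n+2)(x,z,y) − S n x · S 2 (z,y) ≤ ½ Σ_{Y ⊆ x, |Y| odd} [S(Y,z) S(x∖Y,y) + S(Y,y) S(x∖Y,z)]`; multiply by
  `‖y‖^(2Δ)`, let `y → ∞` (`‖y‖^(2Δ) S(n+2)(x,z,y) → A₀(x,z)` from the expansion, `‖y‖^(2Δ) S 2 (z,y) → c`), and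
  bound every factor with one far point by the same tree bound recursively down to the two-point law:
  `0 ≤ A₀(x,z) − c S n x ≤ C(x) ‖z‖^(−2Δ)`, locally uniformly; then `‖z‖^(1−2Δ) → 0` iff `2Δ > 1` (STUB 1).
  Size L (limit bookkeeping), provable now.
* STUB 3 `stub_dipole_clustering` — **dipole clustering, given `1/2 < Δ` AND the monopole rate**: the
  load-bearing, speculative half (route-review: "the dipole clause o(1) is the speculative part"). First-order
  squeezing `0 ≤ T ≤ B` of the truncated function `T = S(n+2)(x,z,·) − S n x · S 2 (z,·)` controls only its
  monopole; the dipole `D_T(x,z) = A₁(x,z) − 2Δc S n x · z` needs a scale-natural SECOND-order far-field remainder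
  `|E(y)| ≤ C(x) ‖z‖^(2−2Δ) ‖y‖^(−2)` for `‖y‖ ≥ 2‖z‖` (quadrupole of a configuration of diameter ≍ ‖z‖), after
  which `|⟪D_T,u⟫| ≤ t (M_B + |E_T| + |E_B|)` at `t ≍ ‖z‖` gives `‖D_T‖ ≲ ‖z‖^(1−2Δ) → 0`. Consistency: for a
  Möbius-covariant limit with convergent far-field asymptotics `⟪D_T, b⟫ = 𝒦̃_b M_T` (the first-multipole identity
  applied to `T`, using `𝒦_b S_n = 0`), of size `‖z‖·O(M_T) + O(‖z‖² ∇_z M_T) = O(‖z‖^(1−2Δ))` — so the stub is a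
  consequence of the conjecture, and its inequality proof is the bet of the route. Size XL, open.

COMPOSITION (`FarFieldClustering_of`, kernel-checked, no `sorry` of its own): introduce the crux data, get `1/2 < Δ`
from STUB 1, the monopole clause from STUB 2, the dipole clause from STUB 3 fed with the monopole clause; the crux is
their conjunction. The arrow form `⟨STUB 1⟩ → ⟨STUB 2⟩ → ⟨STUB 3⟩ → crux` over the three signatures is the
kernel-checked `example` right after it (an `example`, so that exactly ONE declaration of this file concludes the
route decl by name and the file declares no untagged `Prop` definitions).

DISPROOF USED. No `Cruxes/FarFieldClustering/Disproof.lean` exists (crux dir empty at registration); `ledger negatives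
--problem CriticalPhenomena` (11 entries, 2026-08-17) has no statement on this sub-problem's correlation families. The
typing lesson of `Theorems/IsingEuclidUpgradeRefutations.lean` (normalisation `S = 0` off `NonCoincident`) is kept:
every stub carries the crux's hypothesis block verbatim. The barrier `Literature.Barriers.CriticalPhenomena.
ScaleCovarianceNotMoebius` (witness `Δ = 1/2`, `S₄ = Σ_pairs ‖·‖⁻²`) sits exactly at the excluded endpoint of STUB 1
and has no far-field expansion (its `S₄` does not decay as one point recedes), so no stub asserts anything about it.

BC3 PROBES (planner folder `bc/FarFieldClustering_probe_<stub>.lean`, by the book, and `bc/FarFieldClustering_probe2_<stub>.lean`,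
one example per tactic; each file imports only the sub-problem `Statement` and the route file): for each stub signature
`T`, `T → PrimaryAtInfinity.FarFieldClustering` and `T → Ising3DConformalLimit` by
`first | exact? | simpa | simpa [·] | (unfold ·; simpa) | aesop` under `maxHeartbeats 400000` FAIL (6/6: `eta_pos`
"unsolved goals" after aesop's exhaustive search, `monopole_rate` / `dipole_clustering` heartbeat exhaustion inside the
chain), and tactic by tactic FAIL 30/30 (`exact?` "could not close the goal", `aesop` "failed after exhaustive
search", `simpa [crux]` / `unfold; simpa` "assumption failed", `intro …; exact?` "could not close") — STUB 1 has no
clustering content, STUB 2 lacks the dipole clause, STUB 3 needs the monopole clause and `1/2 < Δ` as inputs, and the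
summit needs existence, Möbius covariance and `U₄ ≢ 0` on top of everything here. Skeleton audit
(`#h21_check_skeleton`, `bc/skeleton_preflight.lean`): ok = true, codes [], theorem `…Birth.FarFieldClustering_of`,
closed = false, sorries = the three stubs and nothing else.

Sorries: exactly three, inside `stub_eta_pos`, `stub_monopole_rate`, `stub_dipole_clustering`.
-/

noncomputable section

namespace Summit.CriticalPhenomena.Ising3DConformalLimit.Cruxes.FarFieldClustering.Birth

open Filter Literature.Probability.LatticeModels
open Summit.CriticalPhenomena.Ising3DConformalLimit.Theses

/-! ## The three registered stubs (the only `sorry`s of this file; signatures written out in full) -/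

/-- **STUB 1 (EtaPos) — η > 0 for power-law limits.** Under the hypotheses of the crux (pointwise scaling limit
of the critical `ℤ³` correlators, `ρ > 0` on `(0,1]`, normalised, two-point function `c‖a−b‖^(−2Δ)` with `c > 0`)
the exponent satisfies `1/2 < Δ`. Implied by item 5354 `TwoPointPowerLawEta`; the strict inequality `η > 0` on `ℤ³`
is open (Duminil-Copin ICM 2022 §8.4; bootstrap value η = 0.0362978(20), Poland–Rychkov–Vichi 2019 Table II).
[cite: DuminilCopinICM2022, §8.4 p. 29] [cite: PolandRychkovVichi2019, Table II] -/
theorem stub_eta_pos :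
    ∀ (ρ : ℝ → ℝ) (S : CorrFamily 3) (c Δ : ℝ), (∀ δ ∈ Set.Ioc (0:ℝ) 1, 0 < ρ δ) →
      HasPointwiseScalingLimit (criticalCorr 3) ρ S →
      (∀ n z, z ∉ NonCoincident 3 n → S n z = 0) → 0 < c →
      (∀ a b : EuclideanSpace ℝ (Fin 3), a ≠ b → S 2 ![a, b] = c * ‖a - b‖ ^ (-(2 * Δ))) →
      (1 : ℝ) / 2 < Δ := by
  sorry

/-- **STUB 2 (MonopoleRate) — monopole clustering with rate, given `1/2 < Δ`.** For every normalised pointwise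
scaling limit `S` of `criticalCorr 3` with `S 2 ![a,b] = c‖a−b‖^(−2Δ)`, `c > 0`, `1/2 < Δ`, every `n` and every pair
`(A₀, A₁)` of far-field coefficients of `S (n+2)` (`HasFarFieldExpansion S Δ (n+1) A₀ A₁`, inlined):
`‖z‖ · (A₀ (Fin.snoc x z) − c · S n x) → 0` along `cocompact`, locally uniformly on `NonCoincident 3 n`.
Mechanism: `0 ≤ A₀(x,z) − c S n x ≤ C(x) ‖z‖^(−2Δ)` from GKS II and the Glimm–Jaffe pair-truncation tree bound
(Cor. 4.3.3, in tree for the critical plus state) passed to the scaling limit and iterated down to the two-point law.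
[cite: GlimmJaffe1987, §4.3 Cor. 4.3.3] [cite: Lebowitz1974] -/
theorem stub_monopole_rate :
    ∀ (ρ : ℝ → ℝ) (S : CorrFamily 3) (c Δ : ℝ), (∀ δ ∈ Set.Ioc (0:ℝ) 1, 0 < ρ δ) →
      HasPointwiseScalingLimit (criticalCorr 3) ρ S →
      (∀ n z, z ∉ NonCoincident 3 n → S n z = 0) → 0 < c →
      (∀ a b : EuclideanSpace ℝ (Fin 3), a ≠ b → S 2 ![a, b] = c * ‖a - b‖ ^ (-(2 * Δ))) →
      (1 : ℝ) / 2 < Δ →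
      ∀ (n : ℕ) (A₀ : (Fin (n + 1) → EuclideanSpace ℝ (Fin 3)) → ℝ)
        (A₁ : (Fin (n + 1) → EuclideanSpace ℝ (Fin 3)) → EuclideanSpace ℝ (Fin 3)),
        TendstoLocallyUniformlyOn
            (fun (y : EuclideanSpace ℝ (Fin 3)) (w : Fin (n + 1) → EuclideanSpace ℝ (Fin 3)) =>
              ‖y‖ ^ (2 * Δ + 1) * S (n + 2) (Fin.snoc w y) - ‖y‖ * A₀ w - inner ℝ (A₁ w) (‖y‖⁻¹ • y))
            0 (Filter.cocompact (EuclideanSpace ℝ (Fin 3))) (NonCoincident 3 (n + 1)) →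
        TendstoLocallyUniformlyOn
            (fun (z : EuclideanSpace ℝ (Fin 3)) (x : Fin n → EuclideanSpace ℝ (Fin 3)) =>
              ‖z‖ * (A₀ (Fin.snoc x z) - c * S n x))
            0 (Filter.cocompact (EuclideanSpace ℝ (Fin 3))) (NonCoincident 3 n) := by
  sorry

/-- **STUB 3 (DipoleClustering) — dipole clustering, given `1/2 < Δ` and the monopole rate.** Same data; if
moreover the monopole clusters with rate `o(1/‖z‖)` (conclusion of STUB 2), then
`A₁ (Fin.snoc x z) − (2Δ c · S n x) • z → 0` along `cocompact`, locally uniformly on `NonCoincident 3 n`: the dipole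
moment at infinity of `x ∪ {z}` is asymptotically that of a charge `c · S n x` at `z` (natural size
`‖z‖^(1−2Δ) = ‖z‖^(−η)`). The speculative half of the crux: needs a scale-natural second-order far-field remainder
bound `|E(y)| ≤ C(x)‖z‖^(2−2Δ)‖y‖⁻²` (`‖y‖ ≥ 2‖z‖`) to squeeze the dipole between GKS II and the tree bound at
`‖y‖ ≍ ‖z‖`; consistent with conformal covariance (`⟪D_T, b⟫ = 𝒦̃_b M_T`).
[cite: FrancescoMathieuSenechal1997, §4.2.1 eqs. (4.31)–(4.32)] [cite: GlimmJaffe1987, §4.3 Cor. 4.3.3] -/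
theorem stub_dipole_clustering :
    ∀ (ρ : ℝ → ℝ) (S : CorrFamily 3) (c Δ : ℝ), (∀ δ ∈ Set.Ioc (0:ℝ) 1, 0 < ρ δ) →
      HasPointwiseScalingLimit (criticalCorr 3) ρ S →
      (∀ n z, z ∉ NonCoincident 3 n → S n z = 0) → 0 < c →
      (∀ a b : EuclideanSpace ℝ (Fin 3), a ≠ b → S 2 ![a, b] = c * ‖a - b‖ ^ (-(2 * Δ))) →
      (1 : ℝ) / 2 < Δ →
      ∀ (n : ℕ) (A₀ : (Fin (n + 1) → EuclideanSpace ℝ (Fin 3)) → ℝ)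
        (A₁ : (Fin (n + 1) → EuclideanSpace ℝ (Fin 3)) → EuclideanSpace ℝ (Fin 3)),
        TendstoLocallyUniformlyOn
            (fun (y : EuclideanSpace ℝ (Fin 3)) (w : Fin (n + 1) → EuclideanSpace ℝ (Fin 3)) =>
              ‖y‖ ^ (2 * Δ + 1) * S (n + 2) (Fin.snoc w y) - ‖y‖ * A₀ w - inner ℝ (A₁ w) (‖y‖⁻¹ • y))
            0 (Filter.cocompact (EuclideanSpace ℝ (Fin 3))) (NonCoincident 3 (n + 1)) →
        TendstoLocallyUniformlyOn
            (fun (z : EuclideanSpace ℝ (Fin 3)) (x : Fin n → EuclideanSpace ℝ (Fin 3)) =>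
              ‖z‖ * (A₀ (Fin.snoc x z) - c * S n x))
            0 (Filter.cocompact (EuclideanSpace ℝ (Fin 3))) (NonCoincident 3 n) →
        TendstoLocallyUniformlyOn
            (fun (z : EuclideanSpace ℝ (Fin 3)) (x : Fin n → EuclideanSpace ℝ (Fin 3)) =>
              A₁ (Fin.snoc x z) - (2 * Δ * c * S n x) • z)
            0 (Filter.cocompact (EuclideanSpace ℝ (Fin 3))) (NonCoincident 3 n) := by
  sorry

/-! ## The composition -/

/-- **THE SKELETON THEOREM** — concludes the crux `PrimaryAtInfinity.FarFieldClustering` BY NAME from the three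
registered stubs (pure logic: `1/2 < Δ` from STUB 1 feeds STUBS 2 and 3, the monopole clause from STUB 2 feeds STUB 3,
and the crux is the conjunction of the two clauses). No `sorry` of its own. [folklore] -/
theorem FarFieldClustering_of : PrimaryAtInfinity.FarFieldClustering := by
  intro ρ S c Δ hρ hlim hnorm hc h2pt n A₀ A₁ hexp
  have hΔ : (1 : ℝ) / 2 < Δ := stub_eta_pos ρ S c Δ hρ hlim hnorm hc h2pt
  have hmono := stub_monopole_rate ρ S c Δ hρ hlim hnorm hc h2pt hΔ n A₀ A₁ hexp
  exact ⟨hmono, stub_dipole_clustering ρ S c Δ hρ hlim hnorm hc h2pt hΔ n A₀ A₁ hexp hmono⟩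

/-- **Arrow form** `⟨STUB 1⟩ → ⟨STUB 2⟩ → ⟨STUB 3⟩ → PrimaryAtInfinity.FarFieldClustering`, the three stub
SIGNATURES as hypotheses (kernel-checked `example`, so that `FarFieldClustering_of` stays the only declaration of
this file concluding the route decl by name). [folklore] -/
example :
    (∀ (ρ : ℝ → ℝ) (S : CorrFamily 3) (c Δ : ℝ), (∀ δ ∈ Set.Ioc (0:ℝ) 1, 0 < ρ δ) →
      HasPointwiseScalingLimit (criticalCorr 3) ρ S →
      (∀ n z, z ∉ NonCoincident 3 n → S n z = 0) → 0 < c →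
      (∀ a b : EuclideanSpace ℝ (Fin 3), a ≠ b → S 2 ![a, b] = c * ‖a - b‖ ^ (-(2 * Δ))) →
      (1 : ℝ) / 2 < Δ) →
    (∀ (ρ : ℝ → ℝ) (S : CorrFamily 3) (c Δ : ℝ), (∀ δ ∈ Set.Ioc (0:ℝ) 1, 0 < ρ δ) →
      HasPointwiseScalingLimit (criticalCorr 3) ρ S →
      (∀ n z, z ∉ NonCoincident 3 n → S n z = 0) → 0 < c →
      (∀ a b : EuclideanSpace ℝ (Fin 3), a ≠ b → S 2 ![a, b] = c * ‖a - b‖ ^ (-(2 * Δ))) →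
      (1 : ℝ) / 2 < Δ →
      ∀ (n : ℕ) (A₀ : (Fin (n + 1) → EuclideanSpace ℝ (Fin 3)) → ℝ)
        (A₁ : (Fin (n + 1) → EuclideanSpace ℝ (Fin 3)) → EuclideanSpace ℝ (Fin 3)),
        TendstoLocallyUniformlyOn
            (fun (y : EuclideanSpace ℝ (Fin 3)) (w : Fin (n + 1) → EuclideanSpace ℝ (Fin 3)) =>
              ‖y‖ ^ (2 * Δ + 1) * S (n + 2) (Fin.snoc w y) - ‖y‖ * A₀ w - inner ℝ (A₁ w) (‖y‖⁻¹ • y))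
            0 (Filter.cocompact (EuclideanSpace ℝ (Fin 3))) (NonCoincident 3 (n + 1)) →
        TendstoLocallyUniformlyOn
            (fun (z : EuclideanSpace ℝ (Fin 3)) (x : Fin n → EuclideanSpace ℝ (Fin 3)) =>
              ‖z‖ * (A₀ (Fin.snoc x z) - c * S n x))
            0 (Filter.cocompact (EuclideanSpace ℝ (Fin 3))) (NonCoincident 3 n)) →
    (∀ (ρ : ℝ → ℝ) (S : CorrFamily 3) (c Δ : ℝ), (∀ δ ∈ Set.Ioc (0:ℝ) 1, 0 < ρ δ) →
      HasPointwiseScalingLimit (criticalCorr 3) ρ S →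
      (∀ n z, z ∉ NonCoincident 3 n → S n z = 0) → 0 < c →
      (∀ a b : EuclideanSpace ℝ (Fin 3), a ≠ b → S 2 ![a, b] = c * ‖a - b‖ ^ (-(2 * Δ))) →
      (1 : ℝ) / 2 < Δ →
      ∀ (n : ℕ) (A₀ : (Fin (n + 1) → EuclideanSpace ℝ (Fin 3)) → ℝ)
        (A₁ : (Fin (n + 1) → EuclideanSpace ℝ (Fin 3)) → EuclideanSpace ℝ (Fin 3)),
        TendstoLocallyUniformlyOn
            (fun (y : EuclideanSpace ℝ (Fin 3)) (w : Fin (n + 1) → EuclideanSpace ℝ (Fin 3)) =>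
              ‖y‖ ^ (2 * Δ + 1) * S (n + 2) (Fin.snoc w y) - ‖y‖ * A₀ w - inner ℝ (A₁ w) (‖y‖⁻¹ • y))
            0 (Filter.cocompact (EuclideanSpace ℝ (Fin 3))) (NonCoincident 3 (n + 1)) →
        TendstoLocallyUniformlyOn
            (fun (z : EuclideanSpace ℝ (Fin 3)) (x : Fin n → EuclideanSpace ℝ (Fin 3)) =>
              ‖z‖ * (A₀ (Fin.snoc x z) - c * S n x))
            0 (Filter.cocompact (EuclideanSpace ℝ (Fin 3))) (NonCoincident 3 n) →
        TendstoLocallyUniformlyOn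
            (fun (z : EuclideanSpace ℝ (Fin 3)) (x : Fin n → EuclideanSpace ℝ (Fin 3)) =>
              A₁ (Fin.snoc x z) - (2 * Δ * c * S n x) • z)
            0 (Filter.cocompact (EuclideanSpace ℝ (Fin 3))) (NonCoincident 3 n)) →
    PrimaryAtInfinity.FarFieldClustering := by
  intro h₁ h₂ h₃ ρ S c Δ hρ hlim hnorm hc h2pt n A₀ A₁ hexp
  have hΔ : (1 : ℝ) / 2 < Δ := h₁ ρ S c Δ hρ hlim hnorm hc h2pt
  have hmono := h₂ ρ S c Δ hρ hlim hnorm hc h2pt hΔ n A₀ A₁ hexp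
  exact ⟨hmono, h₃ ρ S c Δ hρ hlim hnorm hc h2pt hΔ n A₀ A₁ hexp hmono⟩

/-- Wiring check: the arrow form instantiated with the registered stubs is the skeleton theorem. [folklore] -/
example : PrimaryAtInfinity.FarFieldClustering := FarFieldClustering_of

/-- Typing remark: the expansion hypothesis of the crux is `HasFarFieldExpansion S Δ (n+1) A₀ A₁` verbatim. [folklore] -/
example (S : CorrFamily 3) (Δ : ℝ) (n : ℕ) (A₀ : (Fin (n + 1) → EuclideanSpace ℝ (Fin 3)) → ℝ)
    (A₁ : (Fin (n + 1) → EuclideanSpace ℝ (Fin 3)) → EuclideanSpace ℝ (Fin 3)) :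
    HasFarFieldExpansion S Δ (n + 1) A₀ A₁ ↔
      TendstoLocallyUniformlyOn
          (fun (y : EuclideanSpace ℝ (Fin 3)) (w : Fin (n + 1) → EuclideanSpace ℝ (Fin 3)) =>
            ‖y‖ ^ (2 * Δ + 1) * S (n + 2) (Fin.snoc w y) - ‖y‖ * A₀ w - inner ℝ (A₁ w) (‖y‖⁻¹ • y))
          0 (Filter.cocompact (EuclideanSpace ℝ (Fin 3))) (NonCoincident 3 (n + 1)) :=
  Iff.rfl

end Summit.CriticalPhenomena.Ising3DConformalLimit.Cruxes.FarFieldClustering.Birth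

end
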